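import Mathlib
import Literature.Analysis.FluidPDE.CurlFreeLiouville
import Literature.Analysis.FluidPDE.VorticityCalculus
import Literature.Analysis.FluidPDE.VectorCalculusProofs
import HarnessLib

/-!
# Crux `ClockStretchingLaw.ClockCeiling` (stmt-NavierStokesRegularity-10570), line `registered`:
# stub `stub_sliceInvariantOfCurlParallel` — the Giga–Miura slice lemma

A bounded `C²` divergence-free field `v : ℝ³ → ℝ³` whose curl is everywhere parallel to a fixed
vector `e ≠ 0` is invariant under every translation along the line `ℝ e`:
`v (x + h e) = v x` for all `x`, `h`. This is the pure vector-calculus core of the step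
"the vorticity points in one fixed direction, hence the (blow-up limit) flow is two-dimensional"
of Giga–Miura 2011 (Comm. Math. Phys. 303, proof of Thm 1.1), restated in Giga–Gu–Hsu 2019,
§2.4 (p. 7), here for a single time slice and without any equation.

Proof. Write `curl v = a e` with the `C¹` scalar `a = ⟪e, curl v⟫ / ‖e‖²`. Since
`div (curl v) = 0` (`divergence_curl_eq_zero_holds`) and `div (a e) = ∂ₑ a`, the derivative of
`t ↦ a (x + t e)` vanishes, so `a`, hence `curl v`, is invariant under the translations along
`e`. For fixed `h` the increment `z = v(· + h e) - v` is `C²`, bounded by `2M`, divergence free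
and curl free, hence constant (`eq_of_curl_eq_zero_of_isDivFree_of_bounded`, the Liouville
theorem for the system `curl z = 0`, `div z = 0` of KNSS 2009, Lemma 3.1); iterating,
`v (x + n h e) - v x = n c` stays bounded by `2M` for all `n : ℕ`, so the constant `c` is `0`.

What is NOT here: anything about the time variable or the Navier–Stokes equations (the
neighbouring stubs of the line carry the dynamics).

References: Y. Giga, H. Miura, Comm. Math. Phys. 303 (2011) 289–300, proof of Thm 1.1;
Y. Giga, Z. Gu, P.-Y. Hsu, Nonlinear Anal. 189 (2019) 111579, §2.4; G. Koch, N. Nadirashvili,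
G. Seregin, V. Šverák, Acta Math. 203 (2009), Lemma 3.1.
-/

-- the summit and its single sub-problem share the name (CONVENTIONS §1), as in every Theorems file
set_option linter.dupNamespace false

noncomputable section

namespace Summit.NavierStokesRegularity.NavierStokesRegularity.Theorems

open Literature.Analysis.FluidPDE
open scoped RealInnerProductSpace

/-- **Curl of a translate**: `curl (v(· + a))(x) = (curl v)(x + a)`, no differentiability
hypothesis (the Jacobian of a translate is the translated Jacobian, Mathlib's
`fderiv_comp_add_right`; re-proof of the tree's `curl_comp_add_const` of `FlatSwirlGauge`,
kept private to avoid that file's import cone). [folklore] -/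
private theorem curl_comp_add_const_aux
    (v : EuclideanSpace ℝ (Fin 3) → EuclideanSpace ℝ (Fin 3)) (a x : EuclideanSpace ℝ (Fin 3)) :
    curl (fun y => v (y + a)) x = curl v (x + a) := by
  -- adapted from `curl_comp_add_const` (`FlatSwirlGauge`)
  simp only [curl, fderiv_comp_add_right]

/-- **Divergence of `g e`**: for a scalar `g` differentiable at `x` and a fixed vector `e`,
`div (g e)(x) = ∂ₑ g (x) = Dg(x) e` (the trace of the rank-one map `Dg(x) ⊗ e`; re-proof of the
tree's `divergence_smul_const_eq_fderiv_apply` of `PressureDeterminedUpToTime`, kept private to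
avoid that file's import cone). [folklore] -/
private theorem divergence_smul_const_aux {g : EuclideanSpace ℝ (Fin 3) → ℝ}
    {x : EuclideanSpace ℝ (Fin 3)} (hg : DifferentiableAt ℝ g x) (e : EuclideanSpace ℝ (Fin 3)) :
    VectorCalculus.divergence (fun y => g y • e) x = fderiv ℝ g x e := by
  -- adapted from `divergence_smul_const_eq_fderiv_apply` (`PressureDeterminedUpToTime`)
  set b := stdOrthonormalBasis ℝ (EuclideanSpace ℝ (Fin 3)) with hb
  rw [divergence_eq_sum_inner_fderiv b]
  have hD : fderiv ℝ (fun y => g y • e) x = (fderiv ℝ g x).smulRight e :=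
    (hg.hasFDerivAt.smul_const e).fderiv
  simp only [hD, ContinuousLinearMap.smulRight_apply, inner_smul_right]
  calc ∑ i, fderiv ℝ g x (b i) * ⟪b i, e⟫ = fderiv ℝ g x (∑ i, ⟪b i, e⟫ • b i) := by
        rw [map_sum]
        refine Finset.sum_congr rfl fun i _ => ?_
        rw [map_smul, smul_eq_mul, mul_comm]
    _ = fderiv ℝ g x e := by rw [b.sum_repr' e]

/-- **Bounded fields have no constant non-zero increments**: if `‖v‖ ≤ M` and
`v (x + b) - v x = κ` for all `x`, then `κ = 0` (by induction `v (x + n b) - v x = n κ`, whose norm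
is at most `2M` for every `n : ℕ`; Archimedes). [folklore] -/
private theorem eq_zero_of_forall_comp_add_sub_eq
    {v : EuclideanSpace ℝ (Fin 3) → EuclideanSpace ℝ (Fin 3)} {M : ℝ} (hM : ∀ x, ‖v x‖ ≤ M)
    {b κ : EuclideanSpace ℝ (Fin 3)} (h : ∀ x, v (x + b) - v x = κ) : κ = 0 := by
  -- adapted from `eq_zero_of_ae_comp_add_sub_eq_const_of_norm_le` (`AncientMildDirectionalInvariance`)
  have hiter : ∀ (n : ℕ) (x : EuclideanSpace ℝ (Fin 3)),
      v (x + (n : ℝ) • b) - v x = (n : ℝ) • κ := by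
    intro n
    induction n with
    | zero => intro x; simp
    | succ n ih =>
      intro x
      have e1 : x + ((n : ℝ) + 1) • b = x + b + (n : ℝ) • b := by
        rw [add_smul, one_smul]; abel
      simp only [Nat.cast_succ, e1]
      calc v (x + b + (n : ℝ) • b) - v x
          = (v (x + b + (n : ℝ) • b) - v (x + b)) + (v (x + b) - v x) := by abel
        _ = (n : ℝ) • κ + κ := by rw [ih (x + b), h x]
        _ = ((n : ℝ) + 1) • κ := by rw [add_smul, one_smul]
  have hbd : ∀ n : ℕ, (n : ℝ) * ‖κ‖ ≤ 2 * M := by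
    intro n
    have h2 : ‖(n : ℝ) • κ‖ ≤ 2 * M := by
      rw [← hiter n 0]
      exact (norm_sub_le _ _).trans (by linarith [hM (0 + (n : ℝ) • b), hM 0])
    rwa [norm_smul, Real.norm_of_nonneg (Nat.cast_nonneg n)] at h2
  by_contra hκ
  have hκ' : 0 < ‖κ‖ := norm_pos_iff.2 hκ
  obtain ⟨n, hn⟩ := exists_nat_gt (2 * M / ‖κ‖)
  have h3 := hbd n
  rw [div_lt_iff₀ hκ'] at hn
  linarith

/-- **Stub `stub_sliceInvariantOfCurlParallel` — the Giga–Miura slice lemma.** A bounded `C²`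
divergence-free field `v` on `ℝ³` whose curl is everywhere parallel to a fixed `e ≠ 0` satisfies
`v (x + h e) = v x` for all `x`, `h`. Proof: with `a = ⟪e, curl v⟫ / ‖e‖²` one has `curl v = a e`,
`∂ₑ a = div (a e) = div (curl v) = 0`, so `a` and `curl v` are invariant along `e`; the increment
`v(· + h e) - v` is then a bounded `C²` field with `curl = 0`, `div = 0`, hence a constant
(`eq_of_curl_eq_zero_of_isDivFree_of_bounded`, KNSS 2009 Lemma 3.1), and a bounded field has no
non-zero constant increment. This is the vector-calculus core of "the vorticity points in one
direction, so the limit flow is two-dimensional" (Giga–Miura 2011, proof of Thm 1.1, as restated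
in Giga–Gu–Hsu 2019, §2.4). [cite: GigaGuHsu2019, §2.4 p. 7 (restating Giga–Miura 2011 proof of Thm 1.1)] -/
theorem stub_sliceInvariantOfCurlParallel : ∀ (v : EuclideanSpace ℝ (Fin 3) → EuclideanSpace ℝ (Fin 3)), ContDiff ℝ 2 v → Literature.Analysis.FluidPDE.VectorCalculus.IsDivFree v → (∃ M : ℝ, ∀ x, ‖v x‖ ≤ M) → ∀ e : EuclideanSpace ℝ (Fin 3), e ≠ 0 → (∀ x, ∃ a : ℝ, Literature.Analysis.FluidPDE.curl v x = a • e) → ∀ (x : EuclideanSpace ℝ (Fin 3)) (h : ℝ), v (x + h • e) = v x := by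
  intro v hv hdiv hbdd e he hpar x h
  obtain ⟨M, hM⟩ := hbdd
  -- Step 1: `curl v = a • e` with a `C¹` scalar `a`
  have hcurl1 : ContDiff ℝ 1 (curl v) := contDiff_curl (n := 1) (by exact_mod_cast hv)
  have he2 : ‖e‖ ^ 2 ≠ 0 := pow_ne_zero 2 (norm_ne_zero_iff.2 he)
  obtain ⟨a, ha1, hcurl_eq⟩ : ∃ a : EuclideanSpace ℝ (Fin 3) → ℝ,
      ContDiff ℝ 1 a ∧ ∀ y, curl v y = a y • e := by
    refine ⟨fun y => ⟪e, curl v y⟫ / ‖e‖ ^ 2, (contDiff_const.inner ℝ hcurl1).div_const _,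
      fun y => ?_⟩
    obtain ⟨a₀, ha₀⟩ := hpar y
    show curl v y = (⟪e, curl v y⟫ / ‖e‖ ^ 2) • e
    rw [ha₀, real_inner_smul_right, real_inner_self_eq_norm_sq, mul_div_assoc, div_self he2,
      mul_one]
  have hadiff : Differentiable ℝ a := ha1.differentiable one_ne_zero
  -- Step 2: `∂ₑ a = div (a e) = div (curl v) = 0`
  have hDa : ∀ y, fderiv ℝ a y e = 0 := by
    intro y
    have h0 : VectorCalculus.divergence (curl v) y = 0 := divergence_curl_eq_zero_holds v hv y
    have hfun : curl v = fun z => a z • e := funext hcurl_eq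
    rwa [hfun, divergence_smul_const_aux (hadiff y) e] at h0
  -- Step 3: `a`, hence `curl v`, is invariant under the translations along `e`
  have ha_inv : ∀ (y : EuclideanSpace ℝ (Fin 3)) (s : ℝ), a (y + s • e) = a y := by
    intro y s
    have hline : ∀ t : ℝ,
        HasDerivAt (fun t : ℝ => a (y + t • e)) (fderiv ℝ a (y + t • e) e) t := by
      intro t
      have h1 : HasDerivAt (fun t : ℝ => y + t • e) e t := by
        simpa using ((hasDerivAt_id t).smul_const e).const_add y
      exact (hadiff (y + t • e)).hasFDerivAt.comp_hasDerivAt t h1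
    have hderiv : ∀ t, deriv (fun t : ℝ => a (y + t • e)) t = 0 := fun t => by
      rw [(hline t).deriv, hDa]
    have hdiff : Differentiable ℝ (fun t : ℝ => a (y + t • e)) := fun t =>
      (hline t).differentiableAt
    simpa using is_const_of_deriv_eq_zero hdiff hderiv s 0
  have hcurl_inv : ∀ (y : EuclideanSpace ℝ (Fin 3)) (s : ℝ), curl v (y + s • e) = curl v y :=
    fun y s => by rw [hcurl_eq (y + s • e), hcurl_eq y, ha_inv]
  -- Step 4: the increment `v(· + h e) - v` is `C²`, bounded, curl free and divergence free
  have hvh : ContDiff ℝ 2 (fun y => v (y + h • e)) := hv.comp (contDiff_id.add contDiff_const)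
  have hz2 : ContDiff ℝ 2 (fun y => v (y + h • e) - v y) := hvh.sub hv
  have hzcurl : ∀ y, curl (fun y => v (y + h • e) - v y) y = 0 := by
    intro y
    rw [curl_sub (hvh.differentiable two_ne_zero y) (hv.differentiable two_ne_zero y),
      curl_comp_add_const_aux v (h • e) y, hcurl_inv, sub_self]
  have hzdiv : VectorCalculus.IsDivFree (fun y => v (y + h • e) - v y) := by
    intro y
    have h1 := hdiv (y + h • e)
    have h2 := hdiv y
    simp only [VectorCalculus.divergence] at h1 h2 ⊢
    rw [fderiv_fun_sub (hvh.differentiable two_ne_zero y) (hv.differentiable two_ne_zero y),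
      fderiv_comp_add_right]
    simp [map_sub, h1, h2]
  have hzM : ∀ y, ‖v (y + h • e) - v y‖ ≤ 2 * M := fun y =>
    (norm_sub_le _ _).trans (by linarith [hM (y + h • e), hM y])
  -- Step 5: hence constant (Liouville for `curl z = 0`, `div z = 0`), and the constant is `0`
  have hzconst : ∀ y, v (y + h • e) - v y = v (0 + h • e) - v 0 := fun y =>
    eq_of_curl_eq_zero_of_isDivFree_of_bounded hz2 hzcurl hzdiv hzM y 0
  have hc : v (0 + h • e) - v 0 = 0 := eq_zero_of_forall_comp_add_sub_eq hM hzconst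
  exact sub_eq_zero.1 ((hzconst x).trans hc)

end Summit.NavierStokesRegularity.NavierStokesRegularity.Theorems

end
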